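import Mathlib
import Summits.NavierStokesRegularity.NavierStokesRegularity.Theorems.EulerZoomLiouvillePowerGaugeEulerLiouvilleRigidFrameEscaping
import HarnessLib

/-!
# RIGID-FRAME-STEADY PAST MEMBERS: the profile is measurable, the background is CO-ROTATED (`η(τ) = R(τ)κ₀`) and can be absorbed
# (crux `EulerZoomLiouville.PowerGaugeEulerLiouville` = stmt-NavierStokesRegularity-19832; «E(3)-steady» stratum, step (0); width seat ns-ezl-w3 g6)

Route №10 `EulerZoomLiouville` (NavierStokesRegularity), crux E.  For a rigid-frame-steady past member
`u(τ, ·) = R(τ) U(R(τ)⁻¹(· − ξ(τ))) + η(τ)` (`τ < T₁ ≤ 0`; `R` any path of linear isometries, `ξ` any centre path, `η` any background) of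
Seregin's power-gauged class, the rigid twin of ns-ezl-w6 g2's `FrameSteady.background_eq_of_gaugeA`:

* `RigidFrame.aestronglyMeasurable_profile`, `RigidFrame.aestronglyMeasurable_slice` — one good slice is locally integrable, and
  `U = R(τ₀)⁻¹(u(τ₀)(R(τ₀)· + ξ(τ₀)) − η(τ₀))`;
* `RigidFrame.background_eq_of_gaugeA` — **THE BACKGROUND IS CO-ROTATED**: `η(τ₂) = R(τ₂)R(τ₁)⁻¹η(τ₁)` for `τ₁, τ₂ < T₁` (`ρ > −1`): the constant
  `w = η(τ₂) − R(τ₂)R(τ₁)⁻¹η(τ₁) = u(τ₂)(y) − R(τ₂)R(τ₁)⁻¹u(τ₁)(R(τ₁)R(τ₂)⁻¹(y − ξ(τ₂)) + ξ(τ₁))` has `L²`-mass `≤ 32c L^{1−2ρ}` on large balls `B_L`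
  (slice `A`-gauge on both slices, the second slice rotated — `RotatingFrame.setLIntegral_ball_comp_isometry` — and translated —
  `FrameSteady.setLIntegral_ball_translate_le`), so it vanishes (`Shifted.growth_of_growth_le`, `NoDrift.eq_zero_of_const_of_lintegral_ball_le`);
* `RigidFrame.exists_profile_noBackground` — hence `u(τ) = R(τ) Ũ(R(τ)⁻¹(· − ξ(τ)))` for all `τ < T₁` with ONE measurable profile
  `Ũ = U + R(T₁ − 1)⁻¹η(T₁ − 1)` and NO background — the normal form in which the dynamics files (`…RigidFrameTensorTest`, `…RigidFrameBodyFrame`)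
  and the stratum `RigidFrame.ae_eq_zero_of_gauge_of_pastRigidFrameSteady` (`…RigidFrameEscaping`) are stated;
* `RigidFrame.ae_eq_zero_of_gauge_of_pastRigidFrameSteady_background` — **E(3)-STEADY PAST MEMBERS WITH BACKGROUND ARE TRIVIAL**: the stratum of
  `…RigidFrameEscaping` (ns-ezl-w3 g6, p677072) for members `u(τ, ·) = R(τ) U(R(τ)⁻¹(· − ξ(τ))) + η(τ)` (`R, ξ ∈ C¹`, `η` ARBITRARY, no confinement),
  and its binder form `RigidFrame.rigidFrameSteady_stratum` for the line `galilean_frames` (the un-confined twin of F1g `Sig.stub_rigidFrameSteadyConfined`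
  with `C¹` frames).

WHAT THIS IS NOT: not NS regularity, not the crux E — tools for one symmetry stratum of the crux CLASS 19832 (MODEL lattice; E/NS strata),
`--supports` stmt-19832; 19832 OPEN. [folklore]
-/

noncomputable section

-- flat `Theorems/<Route><Decl>…` files of one crux share the namespace of the crux (tree convention: `Summit.<S>.<S>.…`)
set_option linter.dupNamespace false

open MeasureTheory Set Filter Topology Metric Function TopologicalSpace
open scoped ENNReal NNReal

namespace Summit.NavierStokesRegularity.NavierStokesRegularity.Theorems.PowerGaugeEulerLiouville

open Literature.Analysis Literature.Analysis.FunctionSpaces Literature.Analysis.FluidPDE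

namespace RigidFrame

variable {u : ℝ → EuclideanSpace ℝ (Fin 3) → EuclideanSpace ℝ (Fin 3)}
  {H : ℝ → EuclideanSpace ℝ (Fin 3) → EuclideanSpace ℝ (Fin 3) →L[ℝ] EuclideanSpace ℝ (Fin 3)}
  {T₁ : ℝ} {U : EuclideanSpace ℝ (Fin 3) → EuclideanSpace ℝ (Fin 3)}
  {R : ℝ → EuclideanSpace ℝ (Fin 3) ≃ₗᵢ[ℝ] EuclideanSpace ℝ (Fin 3)} {ξ η : ℝ → EuclideanSpace ℝ (Fin 3)}

/-! ## The profile of a rigid-frame-steady past member is measurable -/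

/-- **The profile is a.e.-strongly measurable**: one good slice `u(τ₀)` is locally integrable (`FrameSteady.ae_hasWeakFDerivOn_slice_past`), and
`U = R(τ₀)⁻¹(u(τ₀)(R(τ₀)· + ξ(τ₀)) − η(τ₀))`. [folklore] -/
theorem aestronglyMeasurable_profile
    (hH : HasWeakSpatialGradientOn (slab (EuclideanSpace ℝ (Fin 3)) (Iio 0) isOpen_Iio) u H) (hT₁ : T₁ ≤ 0)
    (hu : ∀ τ : ℝ, τ < T₁ → u τ = fun y => R τ (U ((R τ).symm (y - ξ τ))) + η τ) :
    AEStronglyMeasurable U volume := by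
  have hne : (ae (volume.restrict (Iio T₁))).NeBot := by
    rw [ae_neBot, Ne, Measure.restrict_eq_zero, Real.volume_Iio]; exact ENNReal.top_ne_zero
  obtain ⟨τ₀, hτ₀, hτ₀T⟩ := ((FrameSteady.ae_hasWeakFDerivOn_slice_past hH hT₁).and (ae_restrict_mem measurableSet_Iio)).exists
  have h1 : AEStronglyMeasurable (u τ₀) volume := by
    have := hτ₀.locallyIntegrableOn.aestronglyMeasurable
    rwa [Opens.coe_top, Measure.restrict_univ] at this
  have h2 : AEStronglyMeasurable (fun y => u τ₀ (R τ₀ y + ξ τ₀)) volume :=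
    h1.comp_quasiMeasurePreserving
      ((measurePreserving_add_right volume (ξ τ₀)).comp (R τ₀).measurePreserving).quasiMeasurePreserving
  have e : U = fun y => (R τ₀).symm (u τ₀ (R τ₀ y + ξ τ₀) - η τ₀) := by
    funext y; rw [hu τ₀ hτ₀T]; simp
  rw [e]
  exact (R τ₀).symm.continuous.comp_aestronglyMeasurable (h2.sub aestronglyMeasurable_const)

/-- **Every slice of a rigid-frame-steady past member is a.e.-strongly measurable.** [folklore] -/
theorem aestronglyMeasurable_slice
    (hH : HasWeakSpatialGradientOn (slab (EuclideanSpace ℝ (Fin 3)) (Iio 0) isOpen_Iio) u H) (hT₁ : T₁ ≤ 0)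
    (hu : ∀ τ : ℝ, τ < T₁ → u τ = fun y => R τ (U ((R τ).symm (y - ξ τ))) + η τ) {τ : ℝ} (hτ : τ < T₁) :
    AEStronglyMeasurable (u τ) volume := by
  rw [hu τ hτ]
  refine (((R τ).continuous.comp_aestronglyMeasurable ((aestronglyMeasurable_profile hH hT₁ hu).comp_quasiMeasurePreserving
    ((R τ).symm.measurePreserving.comp (measurePreserving_sub_right volume (ξ τ))).quasiMeasurePreserving))).add
    aestronglyMeasurable_const

/-! ## The background is co-rotated (the two-slice `A`-gauge comparison) -/

/-- **THE BACKGROUND OF A RIGID-FRAME-STEADY PAST MEMBER IS CO-ROTATED** (`ρ > −1`): for `τ₁, τ₂ < T₁`, `η(τ₂) = R(τ₂)R(τ₁)⁻¹η(τ₁)`.  The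
constant `w = η(τ₂) − R(τ₂)R(τ₁)⁻¹η(τ₁) = u(τ₂)(y) − R(τ₂)R(τ₁)⁻¹u(τ₁)(R(τ₁)R(τ₂)⁻¹(y − ξ(τ₂)) + ξ(τ₁))` has `L²`-mass `≤ 32c L^{1−2ρ}` on the
balls `B_L`, `L` large (slice `A`-gauge on both slices, `Backward.lintegral_ball_le_of_gaugeA`; the second slice rotated and translated), so it
vanishes. [folklore] -/
theorem background_eq_of_gaugeA
    (hH : HasWeakSpatialGradientOn (slab (EuclideanSpace ℝ (Fin 3)) (Iio 0) isOpen_Iio) u H) (hT₁ : T₁ ≤ 0)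
    (hu : ∀ τ : ℝ, τ < T₁ → u τ = fun y => R τ (U ((R τ).symm (y - ξ τ))) + η τ)
    {ρ : ℝ} (hρ : -1 < ρ) {c : ℝ≥0}
    (hA : ∀ a : ℝ, 0 < a → ENNReal.ofReal (a ^ (2 * ρ)) * cknA a (0 : ℝ × EuclideanSpace ℝ (Fin 3)) u ≤ (c : ℝ≥0∞))
    {τ₁ τ₂ : ℝ} (hτ₁ : τ₁ < T₁) (hτ₂ : τ₂ < T₁) : η τ₂ = R τ₂ ((R τ₁).symm (η τ₁)) := by
  -- the rotation `L = R(τ₁) R(τ₂)⁻¹` and the translation `δ = ξ(τ₁) − L ξ(τ₂)` of the comparison map `y ↦ L y + δ`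
  set L : EuclideanSpace ℝ (Fin 3) ≃ₗᵢ[ℝ] EuclideanSpace ℝ (Fin 3) := (R τ₂).symm.trans (R τ₁) with hL
  have hLa : ∀ y, L y = R τ₁ ((R τ₂).symm y) := fun y => rfl
  set δ : EuclideanSpace ℝ (Fin 3) := ξ τ₁ - L (ξ τ₂) with hδ
  set w : EuclideanSpace ℝ (Fin 3) := η τ₂ - R τ₂ ((R τ₁).symm (η τ₁)) with hw
  -- `w = u τ₂ y − R₂ R₁⁻¹ u τ₁ (L y + δ)` for every `y`
  have hwy : ∀ y, w = u τ₂ y - R τ₂ ((R τ₁).symm (u τ₁ (L y + δ))) := fun y => by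
    rw [hu τ₂ hτ₂, hu τ₁ hτ₁]
    simp only [hδ, hw, hLa, map_add, map_sub, LinearIsometryEquiv.symm_apply_apply]
    abel
  have hm₁ : AEStronglyMeasurable (fun y => R τ₂ ((R τ₁).symm (u τ₁ (L y + δ)))) volume := by
    have h1 : AEStronglyMeasurable (fun y => u τ₁ (L y + δ)) volume :=
      (aestronglyMeasurable_slice hH hT₁ hu hτ₁).comp_quasiMeasurePreserving
        ((measurePreserving_add_right volume δ).comp L.measurePreserving).quasiMeasurePreserving
    exact ((R τ₂).continuous.comp (R τ₁).symm.continuous).comp_aestronglyMeasurable h1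
  -- the growth bound on large balls
  set L₀ : ℝ := |τ₁| + |τ₂| + 2 * (‖ξ τ₁‖ + ‖ξ τ₂‖) + 2 with hL₀
  have hδn : ‖δ‖ ≤ ‖ξ τ₁‖ + ‖ξ τ₂‖ := by
    rw [hδ]
    calc ‖ξ τ₁ - L (ξ τ₂)‖ ≤ ‖ξ τ₁‖ + ‖L (ξ τ₂)‖ := norm_sub_le _ _
      _ = ‖ξ τ₁‖ + ‖ξ τ₂‖ := by rw [LinearIsometryEquiv.norm_map]
  have hL₀1 : 1 ≤ L₀ := by rw [hL₀]; linarith [abs_nonneg τ₁, abs_nonneg τ₂, norm_nonneg (ξ τ₁), norm_nonneg (ξ τ₂)]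
  have hgrow : ∀ Lr : ℝ, L₀ ≤ Lr → ∫⁻ y in ball (0 : EuclideanSpace ℝ (Fin 3)) Lr, ‖(fun _ : EuclideanSpace ℝ (Fin 3) => w) y‖ₑ ^ 2 ≤
      (32 * (c : ℝ≥0∞)) * ENNReal.ofReal (Lr ^ (1 - 2 * ρ)) := by
    intro Lr hLr
    have hL1 : 1 ≤ Lr := hL₀1.trans hLr
    have hLr0 : 0 < Lr := by linarith
    have h2L : 0 < 2 * Lr := by linarith
    have hτ₁I : τ₁ ∈ Ioo (-((2 * Lr) ^ 2)) 0 :=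
      ⟨by nlinarith [neg_abs_le τ₁, abs_nonneg τ₂, norm_nonneg (ξ τ₁), norm_nonneg (ξ τ₂), abs_nonneg τ₁], lt_of_lt_of_le hτ₁ hT₁⟩
    have hτ₂I : τ₂ ∈ Ioo (-((2 * Lr) ^ 2)) 0 :=
      ⟨by nlinarith [neg_abs_le τ₂, abs_nonneg τ₁, norm_nonneg (ξ τ₁), norm_nonneg (ξ τ₂), abs_nonneg τ₂], lt_of_lt_of_le hτ₂ hT₁⟩
    have hA₁ := Backward.lintegral_ball_le_of_gaugeA h2L (hA (2 * Lr) h2L) hτ₁I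
    have hA₂ := Backward.lintegral_ball_le_of_gaugeA h2L (hA (2 * Lr) h2L) hτ₂I
    -- the rotated and translated slice on `B_L` sits in `B_{2L}`
    have hδL : ‖δ‖ ≤ Lr := by linarith [norm_nonneg (ξ τ₁), norm_nonneg (ξ τ₂), abs_nonneg τ₁, abs_nonneg τ₂]
    have htr : ∫⁻ y in ball (0 : EuclideanSpace ℝ (Fin 3)) Lr, ‖R τ₂ ((R τ₁).symm (u τ₁ (L y + δ)))‖ₑ ^ 2 ≤
        ∫⁻ y in ball (0 : EuclideanSpace ℝ (Fin 3)) (2 * Lr), ‖u τ₁ y‖ₑ ^ 2 := by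
      have e1 : ∀ y, ‖R τ₂ ((R τ₁).symm (u τ₁ (L y + δ)))‖ₑ ^ 2 = ‖u τ₁ (L y + δ)‖ₑ ^ 2 := fun y => by
        rw [← ofReal_norm, ← ofReal_norm, LinearIsometryEquiv.norm_map, LinearIsometryEquiv.norm_map]
      calc ∫⁻ y in ball (0 : EuclideanSpace ℝ (Fin 3)) Lr, ‖R τ₂ ((R τ₁).symm (u τ₁ (L y + δ)))‖ₑ ^ 2
          = ∫⁻ y in ball (0 : EuclideanSpace ℝ (Fin 3)) Lr, (fun z => ‖u τ₁ (z + δ)‖ₑ ^ 2) (L y) :=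
            lintegral_congr_ae (Eventually.of_forall e1)
        _ = ∫⁻ z in ball (0 : EuclideanSpace ℝ (Fin 3)) Lr, ‖u τ₁ (z + δ)‖ₑ ^ 2 :=
            RotatingFrame.setLIntegral_ball_comp_isometry L (fun z => ‖u τ₁ (z + δ)‖ₑ ^ 2) Lr
        _ ≤ ∫⁻ y in ball (0 : EuclideanSpace ℝ (Fin 3)) (2 * Lr), ‖u τ₁ y‖ₑ ^ 2 :=
            FrameSteady.setLIntegral_ball_translate_le (fun y => ‖u τ₁ y‖ₑ ^ 2) hδL
    calc ∫⁻ y in ball (0 : EuclideanSpace ℝ (Fin 3)) Lr, ‖(fun _ : EuclideanSpace ℝ (Fin 3) => w) y‖ₑ ^ 2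
        = ∫⁻ y in ball (0 : EuclideanSpace ℝ (Fin 3)) Lr, ‖u τ₂ y - R τ₂ ((R τ₁).symm (u τ₁ (L y + δ)))‖ₑ ^ 2 := by
          refine lintegral_congr_ae (Eventually.of_forall fun y => ?_); simp only [← hwy y]
      _ ≤ ∫⁻ y in ball (0 : EuclideanSpace ℝ (Fin 3)) Lr, (2 * ‖u τ₂ y‖ₑ ^ 2 + 2 * ‖R τ₂ ((R τ₁).symm (u τ₁ (L y + δ)))‖ₑ ^ 2) :=
          lintegral_mono fun y => TypeITraceScarL3.enorm_sub_sq_le _ _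
      _ = (2 * ∫⁻ y in ball (0 : EuclideanSpace ℝ (Fin 3)) Lr, ‖u τ₂ y‖ₑ ^ 2) +
            2 * ∫⁻ y in ball (0 : EuclideanSpace ℝ (Fin 3)) Lr, ‖R τ₂ ((R τ₁).symm (u τ₁ (L y + δ)))‖ₑ ^ 2 := by
          rw [lintegral_add_right' _ ((hm₁.restrict.enorm.pow_const 2).const_mul 2), lintegral_const_mul'' _ (hm₁.restrict.enorm.pow_const 2),
            lintegral_const_mul'' _ ((aestronglyMeasurable_slice hH hT₁ hu hτ₂).restrict.enorm.pow_const 2)]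
      _ ≤ (2 * ENNReal.ofReal ((c : ℝ) * (2 * Lr) ^ (1 - 2 * ρ))) + 2 * ENNReal.ofReal ((c : ℝ) * (2 * Lr) ^ (1 - 2 * ρ)) :=
          add_le_add (mul_le_mul' le_rfl ((lintegral_mono_set (ball_subset_ball (by linarith))).trans hA₂))
            (mul_le_mul' le_rfl (htr.trans hA₁))
      _ ≤ (32 * (c : ℝ≥0∞)) * ENNReal.ofReal (Lr ^ (1 - 2 * ρ)) := by
          -- `(2L)^{1−2ρ} = 2^{1−2ρ} L^{1−2ρ} ≤ 8 L^{1−2ρ}` (`ρ > −1`); adapted from `FrameSteady.background_eq_of_gaugeA`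
          have h2 : (2 : ℝ) ^ (1 - 2 * ρ) ≤ 2 ^ (3 : ℝ) := Real.rpow_le_rpow_of_exponent_le one_le_two (by linarith)
          have h3 : (c : ℝ) * (2 * Lr) ^ (1 - 2 * ρ) ≤ (c : ℝ) * (8 * Lr ^ (1 - 2 * ρ)) := by
            refine mul_le_mul_of_nonneg_left ?_ c.coe_nonneg
            rw [Real.mul_rpow zero_le_two hLr0.le]
            have : (2 : ℝ) ^ (3 : ℝ) = 8 := by norm_num
            nlinarith [Real.rpow_nonneg hLr0.le (1 - 2 * ρ)]
          have h4 : ENNReal.ofReal ((c : ℝ) * (8 * Lr ^ (1 - 2 * ρ))) = 8 * (c : ℝ≥0∞) * ENNReal.ofReal (Lr ^ (1 - 2 * ρ)) := by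
            rw [ENNReal.ofReal_mul c.coe_nonneg, ENNReal.ofReal_mul (by norm_num), ENNReal.ofReal_ofNat, ENNReal.ofReal_coe_nnreal]; ring
          calc (2 * ENNReal.ofReal ((c : ℝ) * (2 * Lr) ^ (1 - 2 * ρ))) + 2 * ENNReal.ofReal ((c : ℝ) * (2 * Lr) ^ (1 - 2 * ρ))
              = 4 * ENNReal.ofReal ((c : ℝ) * (2 * Lr) ^ (1 - 2 * ρ)) := by rw [← two_mul, ← mul_assoc]; norm_num
            _ ≤ 4 * ENNReal.ofReal ((c : ℝ) * (8 * Lr ^ (1 - 2 * ρ))) := mul_le_mul' le_rfl (ENNReal.ofReal_le_ofReal h3)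
            _ = (32 * (c : ℝ≥0∞)) * ENNReal.ofReal (Lr ^ (1 - 2 * ρ)) := by rw [h4]; ring
  obtain ⟨C, hC, hCgrow⟩ := Shifted.growth_of_growth_le (V := fun _ : EuclideanSpace ℝ (Fin 3) => w) continuous_const
    (by linarith : 1 - 2 * ρ ≤ 3) hL₀1 (ENNReal.mul_ne_top ENNReal.ofNat_ne_top ENNReal.coe_ne_top) hgrow
  have hw0 : w = 0 := NoDrift.eq_zero_of_const_of_lintegral_ball_le hC (by linarith) hCgrow
  rw [hw] at hw0
  exact (sub_eq_zero.1 hw0)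

/-- **A rigid-frame-steady past member is ONE measurable profile carried along the rigid motion, with NO background**:
`u(τ) = R(τ) Ũ(R(τ)⁻¹(· − ξ(τ)))` for all `τ < T₁`, `Ũ = U + R(T₁ − 1)⁻¹η(T₁ − 1)` a.e.-strongly measurable (`ρ > −1`). [folklore] -/
theorem exists_profile_noBackground
    (hH : HasWeakSpatialGradientOn (slab (EuclideanSpace ℝ (Fin 3)) (Iio 0) isOpen_Iio) u H) (hT₁ : T₁ ≤ 0)
    (hu : ∀ τ : ℝ, τ < T₁ → u τ = fun y => R τ (U ((R τ).symm (y - ξ τ))) + η τ)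
    {ρ : ℝ} (hρ : -1 < ρ) {c : ℝ≥0}
    (hA : ∀ a : ℝ, 0 < a → ENNReal.ofReal (a ^ (2 * ρ)) * cknA a (0 : ℝ × EuclideanSpace ℝ (Fin 3)) u ≤ (c : ℝ≥0∞)) :
    ∃ U' : EuclideanSpace ℝ (Fin 3) → EuclideanSpace ℝ (Fin 3), AEStronglyMeasurable U' volume ∧
      ∀ τ : ℝ, τ < T₁ → u τ = fun y => R τ (U' ((R τ).symm (y - ξ τ))) := by
  refine ⟨fun y => U y + (R (T₁ - 1)).symm (η (T₁ - 1)),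
    (aestronglyMeasurable_profile hH hT₁ hu).add aestronglyMeasurable_const, fun τ hτ => ?_⟩
  rw [hu τ hτ, background_eq_of_gaugeA hH hT₁ hu hρ hA (by linarith : T₁ - 1 < T₁) hτ]
  funext y
  rw [map_add]

/-! ## The stratum with background -/

/-- **E(3)-STEADY PAST MEMBERS (WITH BACKGROUND) ARE TRIVIAL** (`0 < ρ ≤ 1/2`).  Let `(u, p)` be a suitable weak Euler pair on `(−∞,0) × ℝ³`
with weak spatial gradient `H` in Seregin's class `a^{2ρ}A(a) + a^{ρ}E(a) + a^{2ρ}D(a) ≤ c` (all `a > 0`), and suppose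
`u(τ, ·) = R(τ) U(R(τ)⁻¹(· − ξ(τ))) + η(τ)` for all `τ < T₁ ≤ 0` with an arbitrary profile `U`, an arbitrary background `η`, and `C¹` paths `R` (linear
isometries) and `ξ` (centre; NO growth condition).  Then `u = 0` a.e. on the slab: absorb the co-rotated background (`exists_profile_noBackground`)
and apply `RigidFrame.ae_eq_zero_of_gauge_of_pastRigidFrameSteady`. [folklore; MajdaBertozzi2002 Prop. 1.1 p. 12] -/
theorem ae_eq_zero_of_gauge_of_pastRigidFrameSteady_background {ρ : ℝ} (hρ : 0 < ρ) (hρ2 : ρ ≤ 1 / 2)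
    {p : ℝ → EuclideanSpace ℝ (Fin 3) → ℝ} {c : ℝ≥0}
    (hsw : IsSuitableWeakSolutionOn (slab (EuclideanSpace ℝ (Fin 3)) (Iio 0) isOpen_Iio) 0 0 u p)
    (hH : HasWeakSpatialGradientOn (slab (EuclideanSpace ℝ (Fin 3)) (Iio 0) isOpen_Iio) u H)
    (hc : ∀ a : ℝ, 0 < a → ENNReal.ofReal (a ^ (2 * ρ)) * cknA a (0 : ℝ × EuclideanSpace ℝ (Fin 3)) u +
        ENNReal.ofReal (a ^ ρ) * cknE a (0 : ℝ × EuclideanSpace ℝ (Fin 3)) H +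
        ENNReal.ofReal (a ^ (2 * ρ)) * cknD a (0 : ℝ × EuclideanSpace ℝ (Fin 3)) p ≤ (c : ℝ≥0∞))
    (hT₁ : T₁ ≤ 0)
    (hR : ContDiff ℝ 1 (fun τ => (R τ : EuclideanSpace ℝ (Fin 3) →L[ℝ] EuclideanSpace ℝ (Fin 3)))) (hξ : ContDiff ℝ 1 ξ)
    (hu : ∀ τ : ℝ, τ < T₁ → u τ = fun y => R τ (U ((R τ).symm (y - ξ τ))) + η τ) :
    uncurry u =ᵐ[volume.restrict (Iio (0 : ℝ) ×ˢ (univ : Set (EuclideanSpace ℝ (Fin 3))))] 0 := by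
  have hA : ∀ a : ℝ, 0 < a → ENNReal.ofReal (a ^ (2 * ρ)) * cknA a (0 : ℝ × EuclideanSpace ℝ (Fin 3)) u ≤ (c : ℝ≥0∞) :=
    fun a ha => le_trans (le_trans le_self_add le_self_add) (hc a ha)
  obtain ⟨U', -, hu'⟩ := exists_profile_noBackground hH hT₁ hu (by linarith : (-1 : ℝ) < ρ) hA
  exact ae_eq_zero_of_gauge_of_pastRigidFrameSteady hρ hρ2 hsw hH hc hT₁ hR hξ hu'

/-- **BINDER FORM for the line `galilean_frames`** (the un-confined twin of F1g `Sig.stub_rigidFrameSteadyConfined`, with the line's reducible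
`InClass` / `VanishesAE` unfolded and `C¹` frame paths in place of `IsSubcriticalFrame`): every rigid-frame-steady past member
`u τ = fun y => R τ (U ((R τ).symm (y − ξ τ))) + η τ` (`τ < T₁ ≤ 0`) of Seregin's class with `C¹` rotation and centre paths is trivial.
[folklore; MajdaBertozzi2002 Prop. 1.1 p. 12] -/
theorem rigidFrameSteady_stratum :
    ∀ ρ : ℝ, 0 < ρ → ρ ≤ 1 / 2 →
      ∀ (u : ℝ → EuclideanSpace ℝ (Fin 3) → EuclideanSpace ℝ (Fin 3)) (p : ℝ → EuclideanSpace ℝ (Fin 3) → ℝ)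
        (H : ℝ → EuclideanSpace ℝ (Fin 3) → EuclideanSpace ℝ (Fin 3) →L[ℝ] EuclideanSpace ℝ (Fin 3)) (c : ℝ≥0),
      (IsSuitableWeakSolutionOn (slab (EuclideanSpace ℝ (Fin 3)) (Set.Iio 0) isOpen_Iio) 0 0 u p ∧
        HasWeakSpatialGradientOn (slab (EuclideanSpace ℝ (Fin 3)) (Set.Iio 0) isOpen_Iio) u H ∧
        (∀ a : ℝ, 0 < a →
          ENNReal.ofReal (a ^ (2 * ρ)) * cknA a (0 : ℝ × EuclideanSpace ℝ (Fin 3)) u +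
              ENNReal.ofReal (a ^ ρ) * cknE a (0 : ℝ × EuclideanSpace ℝ (Fin 3)) H +
            ENNReal.ofReal (a ^ (2 * ρ)) * cknD a (0 : ℝ × EuclideanSpace ℝ (Fin 3)) p ≤ (c : ℝ≥0∞))) →
      ∀ (T₁ : ℝ) (U : EuclideanSpace ℝ (Fin 3) → EuclideanSpace ℝ (Fin 3))
        (R : ℝ → EuclideanSpace ℝ (Fin 3) ≃ₗᵢ[ℝ] EuclideanSpace ℝ (Fin 3)) (ξ η : ℝ → EuclideanSpace ℝ (Fin 3)),
        T₁ ≤ 0 → ContDiff ℝ 1 (fun τ => (R τ : EuclideanSpace ℝ (Fin 3) →L[ℝ] EuclideanSpace ℝ (Fin 3))) → ContDiff ℝ 1 ξ →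
        (∀ τ : ℝ, τ < T₁ → u τ = fun y => R τ (U ((R τ).symm (y - ξ τ))) + η τ) →
        Function.uncurry u =ᵐ[volume.restrict (Set.Iio (0 : ℝ) ×ˢ (Set.univ : Set (EuclideanSpace ℝ (Fin 3))))] 0 :=
  fun _ hρ hρ2 _ _ _ _ h _ _ _ _ _ hT₁ hR hξ hu =>
    ae_eq_zero_of_gauge_of_pastRigidFrameSteady_background hρ hρ2 h.1 h.2.1 h.2.2 hT₁ hR hξ hu

/-- **LEAD's `IsPastSteady` ALTERNATIVE 9 (binder text of ns-typeII-p2 g13, 23:03Z, verbatim)**: a member of the class which is, on some past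
window, a fixed profile in a `C¹` rigidly moving frame plus a background vanishes a.e. on the slab. [folklore; MajdaBertozzi2002 Prop. 1.1 p. 12] -/
theorem ae_eq_zero_of_gauge_of_isPastRigidFrameSteadyC1 {ρ : ℝ} (hρ : 0 < ρ) (hρ2 : ρ ≤ 1 / 2)
    {p : ℝ → EuclideanSpace ℝ (Fin 3) → ℝ} {c : ℝ≥0}
    (hsw : IsSuitableWeakSolutionOn (slab (EuclideanSpace ℝ (Fin 3)) (Iio 0) isOpen_Iio) 0 0 u p)
    (hH : HasWeakSpatialGradientOn (slab (EuclideanSpace ℝ (Fin 3)) (Iio 0) isOpen_Iio) u H)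
    (hc : ∀ a : ℝ, 0 < a → ENNReal.ofReal (a ^ (2 * ρ)) * cknA a (0 : ℝ × EuclideanSpace ℝ (Fin 3)) u +
        ENNReal.ofReal (a ^ ρ) * cknE a (0 : ℝ × EuclideanSpace ℝ (Fin 3)) H +
        ENNReal.ofReal (a ^ (2 * ρ)) * cknD a (0 : ℝ × EuclideanSpace ℝ (Fin 3)) p ≤ (c : ℝ≥0∞))
    (h : ∃ (T₁ : ℝ) (U : EuclideanSpace ℝ (Fin 3) → EuclideanSpace ℝ (Fin 3))
        (R : ℝ → (EuclideanSpace ℝ (Fin 3) ≃ₗᵢ[ℝ] EuclideanSpace ℝ (Fin 3))) (ξ η : ℝ → EuclideanSpace ℝ (Fin 3)),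
        T₁ ≤ 0 ∧ ContDiff ℝ 1 (fun τ => ((R τ : EuclideanSpace ℝ (Fin 3) ≃ₗᵢ[ℝ] EuclideanSpace ℝ (Fin 3)) :
          EuclideanSpace ℝ (Fin 3) →L[ℝ] EuclideanSpace ℝ (Fin 3))) ∧ ContDiff ℝ 1 ξ ∧
        ∀ τ : ℝ, τ < T₁ → u τ = fun y => R τ (U ((R τ).symm (y - ξ τ))) + η τ) :
    uncurry u =ᵐ[volume.restrict (Iio (0 : ℝ) ×ˢ (univ : Set (EuclideanSpace ℝ (Fin 3))))] 0 := by
  obtain ⟨T₁, U, R, ξ, η, hT₁, hR, hξ, hu⟩ := h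
  exact ae_eq_zero_of_gauge_of_pastRigidFrameSteady_background hρ hρ2 hsw hH hc hT₁ hR hξ hu

end RigidFrame

end Summit.NavierStokesRegularity.NavierStokesRegularity.Theorems.PowerGaugeEulerLiouville

end
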